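import Summits.CriticalPhenomena.PercolationContinuityZ3.Theorems.PercLowPointHalfSpaceTallClusterMassBoundOnesidedHalvesTypicalMaxGrowthForms
import Summits.CriticalPhenomena.PercolationContinuityZ3.Theorems.PercLowPointHalfSpaceTallClusterMassBoundOnesidedHalvesTypicalMaxLinearLower

/-!
# `TallClusterMassBound` (stmt-CriticalPhenomena-0912), line `onesided-halves` — stub G: EVENTUAL fixed-ratio doubling suffices

Stub G (`stub_typicalMaxPolyGrowth`: `∃ c κ > 0, ∀ 1 ≤ ρ ≤ r, c (r/ρ)^κ M(Λ_ρ) ≤ M(Λ_r)`, `M(Λ) = typicalMax P^ℍ_{p_c} Λ`,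
`Λ_r = halfBox r`) is equivalent to fixed-ratio doubling `∃ L ≥ 2, ∀ r ≥ 1, 2 M(Λ_r) ≤ M(Λ_{Lr})`
(`typicalMaxPolyGrowth_iff_fixedRatio`, file `…OnesidedHalvesTypicalMaxGrowthForms.lean`). With the critical linear floor
`M(Λ_r) ≥ r/96` (`typicalMax_halfBox_ge_linear`, file `…OnesidedHalvesTypicalMaxLinearLower.lean`, from `φ_{p_c}(B_n) ≥ 1`)
the small scales take care of themselves:

  `typicalMaxPolyGrowth_iff_eventually_fixedRatio : G ↔ ∃ L r₀, 2 ≤ L ∧ ∀ r ≥ r₀, 2 M(Λ_r) ≤ M(Λ_{Lr})`.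

(`←`: for `r ≥ r₀` iterate the doubling `m` times along the powers of `L`; for `1 ≤ r < r₀`,
`2 M(Λ_r) ≤ 2(|Λ_{r₀}| + 1) ≤ L^m/96 ≤ M(Λ_{L^m r})` once `L^m ≥ 192 (|Λ_{r₀}| + 1)`; so the ratio `L^m` doubles at every
scale.) So the open content of G is a purely ASYMPTOTIC merging statement across one fixed scale ratio. No Theses statement
is touched; no definitions.
-/

noncomputable section

open MeasureTheory Finset Filter
open Literature.Probability.Percolation Literature.Probability.LatticeModels
open Summit.CriticalPhenomena.PercolationContinuityZ3.Theorems.TallClusterMassBound.Negative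
open Summit.CriticalPhenomena.PercolationContinuityZ3.Theorems.TallClusterMassBound.TightnessLine

namespace Summit.CriticalPhenomena.PercolationContinuityZ3.Theorems.TallClusterMassBound.OnesidedHalves

/-- Iterating an eventual fixed-ratio doubling: `2^j M(Λ_r) ≤ M(Λ_{L^j r})` for `r ≥ r₀`. [folklore] -/
theorem typicalMax_pow_mul_ge_of_le (μ : Measure (BondConfig V3)) {L r₀ : ℕ} (hL : 1 ≤ L)
    (h : ∀ r : ℕ, r₀ ≤ r → 2 * typicalMax μ (halfBox r) ≤ typicalMax μ (halfBox (L * r))) :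
    ∀ j r : ℕ, r₀ ≤ r → 2 ^ j * typicalMax μ (halfBox r) ≤ typicalMax μ (halfBox (L ^ j * r))
  | 0, r, _ => by simp
  | j + 1, r, hr => by
    have ih := typicalMax_pow_mul_ge_of_le μ hL h j r hr
    have hle : r₀ ≤ L ^ j * r := le_trans hr (Nat.le_mul_of_pos_left r (pow_pos hL j))
    calc 2 ^ (j + 1) * typicalMax μ (halfBox r) = 2 * (2 ^ j * typicalMax μ (halfBox r)) := by ring
      _ ≤ 2 * typicalMax μ (halfBox (L ^ j * r)) := Nat.mul_le_mul_left 2 ih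
      _ ≤ typicalMax μ (halfBox (L * (L ^ j * r))) := h _ hle
      _ = typicalMax μ (halfBox (L ^ (j + 1) * r)) := by rw [pow_succ]; congr 2; ring

/-- **Eventual fixed-ratio doubling ⟹ fixed-ratio doubling at every scale** (with the larger ratio `L^m`), by the
critical linear floor `M(Λ_n) ≥ n/96` at the small scales. [folklore] -/
theorem fixedRatio_of_eventually_fixedRatio {L r₀ : ℕ} (hL : 2 ≤ L)
    (h : ∀ r : ℕ, r₀ ≤ r →
      2 * typicalMax (floorDilutedPercolation 3 (criticalProbI 3) 1) (halfBox r) ≤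
        typicalMax (floorDilutedPercolation 3 (criticalProbI 3) 1) (halfBox (L * r))) :
    ∃ L' : ℕ, 2 ≤ L' ∧ ∀ r : ℕ, 1 ≤ r →
      2 * typicalMax (floorDilutedPercolation 3 (criticalProbI 3) 1) (halfBox r) ≤
        typicalMax (floorDilutedPercolation 3 (criticalProbI 3) 1) (halfBox (L' * r)) := by
  set P := floorDilutedPercolation 3 (criticalProbI 3) 1 with hP
  set K : ℕ := (halfBox r₀).card + 1 with hK
  set m : ℕ := 192 * K with hm
  have hm1 : 1 ≤ m := by rw [hm, hK]; omega
  have hL1 : 1 ≤ L := by omega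
  -- `L^m ≥ 2^m > m = 192 K`
  have hLm : 192 * K < L ^ m := by
    calc 192 * K = m := hm.symm
      _ < 2 ^ m := Nat.lt_two_pow_self
      _ ≤ L ^ m := Nat.pow_le_pow_left hL m
  have hL'2 : 2 ≤ L ^ m := le_trans hL (by simpa using Nat.pow_le_pow_right (by omega : 1 ≤ L) hm1)
  have hKbound : ∀ n : ℕ, n ≤ r₀ → typicalMax P (halfBox n) ≤ K := fun n hn =>
    (typicalMax_halfBox_mono P hn).trans (typicalMax_le_card_add_one P (halfBox r₀))
  clear_value K m
  refine ⟨L ^ m, hL'2, fun r hr => ?_⟩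
  rcases le_or_gt r₀ r with hr₀ | hr₀
  · -- large scales: iterate `m ≥ 1` times
    calc 2 * typicalMax P (halfBox r) ≤ 2 ^ m * typicalMax P (halfBox r) :=
          Nat.mul_le_mul_right _ (by simpa using Nat.pow_le_pow_right (show 1 ≤ 2 by norm_num) hm1)
      _ ≤ typicalMax P (halfBox (L ^ m * r)) := typicalMax_pow_mul_ge_of_le P hL1 h m r hr₀
  · -- small scales `1 ≤ r < r₀`: `2 M(Λ_r) ≤ 2K ≤ L^m / 96 ≤ M(Λ_{L^m r})`
    have hMK : typicalMax P (halfBox r) ≤ K := hKbound r hr₀.le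
    have hlin := typicalMax_halfBox_ge_linear (L ^ m * r)
    have hreal : ((2 * typicalMax P (halfBox r) : ℕ) : ℝ) ≤ typicalMax P (halfBox (L ^ m * r)) := by
      have h1 : ((2 * typicalMax P (halfBox r) : ℕ) : ℝ) ≤ 2 * K := by exact_mod_cast Nat.mul_le_mul_left 2 hMK
      have h2 : (192 * (K : ℝ)) ≤ (L : ℝ) ^ m := by exact_mod_cast hLm.le
      have h3 : (L : ℝ) ^ m ≤ (L : ℝ) ^ m * r := by
        have : (1 : ℝ) ≤ r := by exact_mod_cast hr
        nlinarith [pow_pos (show (0 : ℝ) < L by positivity) m]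
      have h4 : ((L ^ m * r : ℕ) : ℝ) = (L : ℝ) ^ m * r := by push_cast; ring
      rw [h4] at hlin
      linarith
    exact_mod_cast hreal

/-- **G ⟺ EVENTUAL fixed-ratio doubling of the typical maximum.** [folklore] -/
theorem typicalMaxPolyGrowth_iff_eventually_fixedRatio :
    (∃ c κ : ℝ, 0 < c ∧ 0 < κ ∧ ∀ ρ r : ℕ, 1 ≤ ρ → ρ ≤ r →
      c * ((r : ℝ) / ρ) ^ κ * (typicalMax (floorDilutedPercolation 3 (criticalProbI 3) 1) (halfBox ρ) : ℝ) ≤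
        typicalMax (floorDilutedPercolation 3 (criticalProbI 3) 1) (halfBox r)) ↔
    (∃ L r₀ : ℕ, 2 ≤ L ∧ ∀ r : ℕ, r₀ ≤ r →
      2 * typicalMax (floorDilutedPercolation 3 (criticalProbI 3) 1) (halfBox r) ≤
        typicalMax (floorDilutedPercolation 3 (criticalProbI 3) 1) (halfBox (L * r))) := by
  rw [typicalMaxPolyGrowth_iff_fixedRatio]
  constructor
  · rintro ⟨L, hL, h⟩
    exact ⟨L, 1, hL, h⟩
  · rintro ⟨L, r₀, hL, h⟩
    exact fixedRatio_of_eventually_fixedRatio hL h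

/-- **G ⟺ the EVENTUAL merging estimate**: for some fixed `L ≥ 2` and all large `r`, with `P^ℍ_{p_c}`-probability
`> e^{-1}` one open cluster has at least `2 M(Λ_r) - 1` vertices in `Λ_{Lr}`. [folklore] -/
theorem typicalMaxPolyGrowth_iff_eventually_merging :
    (∃ c κ : ℝ, 0 < c ∧ 0 < κ ∧ ∀ ρ r : ℕ, 1 ≤ ρ → ρ ≤ r →
      c * ((r : ℝ) / ρ) ^ κ * (typicalMax (floorDilutedPercolation 3 (criticalProbI 3) 1) (halfBox ρ) : ℝ) ≤
        typicalMax (floorDilutedPercolation 3 (criticalProbI 3) 1) (halfBox r)) ↔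
    (∃ L r₀ : ℕ, 2 ≤ L ∧ ∀ r : ℕ, r₀ ≤ r →
      Real.exp (-1) < (floorDilutedPercolation 3 (criticalProbI 3) 1).real
        {ω | 2 * typicalMax (floorDilutedPercolation 3 (criticalProbI 3) 1) (halfBox r) - 1 ≤
          clusterMaxIn (halfBox (L * r)) ω}) := by
  rw [typicalMaxPolyGrowth_iff_eventually_fixedRatio]
  refine exists_congr fun L => exists_congr fun r₀ => and_congr_right fun _ =>
    forall_congr' fun r => imp_congr_right fun _ => ?_
  exact two_mul_typicalMax_le_iff r (halfBox (L * r))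

end Summit.CriticalPhenomena.PercolationContinuityZ3.Theorems.TallClusterMassBound.OnesidedHalves

end
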